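import Summits.CriticalPhenomena.SAWScalingLimit.Theorems.SAWDefectDecoherenceBoundaryClosureRGateDbarLayers
import Summits.CriticalPhenomena.SAWScalingLimit.Theorems.SAWDefectDecoherenceHexObservableLimitRGreenLimit
import Summits.CriticalPhenomena.SAWScalingLimit.Theorems.SAWDefectDecoherenceBoundaryClosureRPickEngineWeakDbarLocal
import Summits.CriticalPhenomena.SAWScalingLimit.Theorems.SAWDefectDecoherenceBoundaryClosureRPickEngineStarRegrouping
import Summits.CriticalPhenomena.SAWScalingLimit.Theorems.SAWDefectDecoherenceBoundaryClosureRGateMassLaws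
import HarnessLib

/-!
# Gate `∂̄`-limit, II: the twisted term at one mesh
(crux `BoundaryClosureR`, stmt-CriticalPhenomena-14004, line `polygon-parity-squeeze`, registered
stub `stub_gateDbarLimit`, mechanism (C))

In the Taylor-expanded discrete Green identity at scale `δ` (`HexObservableLimitR.greenLimit_identity`:
DCS Lemma 1 summed against `χ(δ c_v)` and regrouped by edges) the TWISTED term is
`T_δ(ψ) := Σ_{v up, t ∼ v, both in Λ} 12 (mid − c_v)² ψ(δ·mid) δ² F({v,t}) / F(b)`, `ψ = ∂χ`.
This file bounds it at ONE mesh from `DefectDecoherence` and the gate layer budget: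

* `sq_mid_sub_center` — `(mid − c_v)² = ± (3a³/2)·conj(mid − c_v)` (sign = parity of `v`; the cube
  identity `u² = 3a³ ū` of the honeycomb, `Engine.sq_eq_of_mem_nbrs_up`), so that regrouping the
  edge sum by BOTH endpoints (`twisted_regroup`) turns `T_δ` into `Σ_v ±9a³ δ²/F(b) ·
  Σ_{t ∼ v} conj(mid − c_v) ψ(δ mid) F({v,t})`, and freezing `ψ` at the centre costs `O(δ·star mass)`
  (`norm_conjStar_sub_le`): what is left is EXACTLY the star sum of `DefectDecoherence`;
* `twisted_norm_le_at` — for a vertex of row `m + k`, `k ≥ 1`, with scaled centre in the quarter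
  gate ball, `DefectDecoherence` at depth `(k+1)/2` (`GateDbar.deep_of_row`) gives
  `‖star sum‖ ≤ C 2^θ (k+1)^{-θ} starMass`; row `k = 0` is bounded trivially; the layer cake
  (`GateDbar.layerCake_le`) then yields
  `‖T_δ(ψ)‖ ≤ 6 C_B δ Σ_{k ≤ K} (‖ψ‖_∞ A₀ (k+1)^{-θ} + L_ψ δ/4)(k+1)^{3/4}`, `ρ/δ ≤ K + 1`.

The limit `δ → 0⁺` is taken in `…GateDbarLimit.lean`.  Reference: Duminil-Copin–Smirnov, Ann. of
Math. 175 (2012), §3 (Lemma 1, summation by parts); the route card of `DefectDecoherence`.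
-/

noncomputable section

open scoped BigOperators Topology Classical ComplexConjugate
open Filter Set Metric Complex
open Literature.Probability.LatticeModels Literature.Probability.RandomPlanarGeometry
open Literature.Probability.RandomPlanarGeometry.SAW
open Literature.Barriers.CriticalPhenomena.HexGreen (nbrs mem_nbrs_iff)
open Literature.Barriers.CriticalPhenomena.HexKernel (vecA)
open Summit.CriticalPhenomena.SAWScalingLimit.Theorems.PickHalfPlane
open Summit.CriticalPhenomena.SAWScalingLimit.Theorems.HexObservableLimitR (greenLimit_sum_adj_eq_sum_black)
open Summit.CriticalPhenomena.SAWScalingLimit.Theorems.DecoherenceSynthesis (hexMidpoint_sub_hexCenter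
  norm_hexMidpoint_sub_hexCenter_le)
open Summit.CriticalPhenomena.SAWScalingLimit.Theorems.ObservableToSLE.FloorRatio (dist_smul_mesh)

namespace Summit.CriticalPhenomena.SAWScalingLimit.Theorems.PolygonParitySqueeze.GateDbar

/-! ### 1. Algebra at a vertex star -/

/-- **The square of a half-edge vector is a conjugate half-edge vector.** For adjacent faces
`v ∼ w`, `(mid{v,w} − c_v)² = ε_v (3a³/2) conj(mid{v,w} − c_v)` with `ε_v = +1` at an up face and
`−1` at a down face (the three directions at a vertex differ by `120°`; `u² = 3a³ ū` for the
up-to-down vectors `u ∈ {a, b, c}`). [folklore] -/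
theorem sq_mid_sub_center {v w : HexVertex} (h : hexGraph.Adj v w) :
    (hexMidpoint s(v, w) - hexCenter v) ^ 2 =
      (if v.2 = 0 then 1 else -1) * (3 * vecA ^ 3 / 2) * conj (hexMidpoint s(v, w) - hexCenter v) := by
  rw [hexMidpoint_sub_hexCenter, map_div₀, Complex.conj_ofNat]
  have hw : w ∈ nbrs v := (mem_nbrs_iff v w).2 h
  rcases Engine.snd_eq_zero_or_one v with hv | hv
  · rw [if_pos hv]
    have hsq := (Engine.sq_eq_of_mem_nbrs_up hv hw).2
    linear_combination (1 / 4 : ℂ) * hsq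
  · rw [if_neg (by rw [hv]; decide)]
    have hw0 : w.2 = 0 := Engine.snd_eq_zero_of_mem_nbrs hv hw
    have hv' : v ∈ nbrs w := (Literature.Barriers.CriticalPhenomena.HexGreen.mem_nbrs_comm w v).2 hw
    have hsq := (Engine.sq_eq_of_mem_nbrs_up hw0 hv').2
    have e : hexCenter w - hexCenter v = -(hexCenter v - hexCenter w) := by ring
    rw [e, map_neg]
    linear_combination (1 / 4 : ℂ) * hsq

/-- `‖3a³/2‖ ≤ 1` (indeed `= 1/(2√3)`). [folklore] -/
theorem norm_coeff_le_one : ‖(3 * vecA ^ 3 / 2 : ℂ)‖ ≤ 1 := by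
  have h : ‖vecA‖ ^ 2 = 1 / 3 := by
    have h1 := LocalL1.conj_vecA_mul_vecA
    rw [Complex.conj_mul'] at h1
    have h' : ((‖vecA‖ ^ 2 : ℝ) : ℂ) = ((1 / 3 : ℝ) : ℂ) := by
      push_cast; exact_mod_cast h1
    exact_mod_cast h'
  have hle : ‖vecA‖ ≤ 1 := by nlinarith [norm_nonneg vecA]
  have h3 : ‖vecA‖ ^ 3 ≤ 1 / 3 := by
    calc ‖vecA‖ ^ 3 = ‖vecA‖ ^ 2 * ‖vecA‖ := by ring
      _ ≤ 1 / 3 * 1 := by rw [h]; exact mul_le_mul_of_nonneg_left hle (by norm_num)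
      _ = 1 / 3 := by ring
  rw [norm_div, norm_mul, Complex.norm_ofNat, Complex.norm_ofNat, norm_pow]
  linarith

/-! ### 2. Regrouping the twisted edge sum by both endpoints -/

/-- **Twisted regrouping.** The up-oriented twisted edge sum equals the sum over ALL vertices of
half the contribution of their stars (the summand is symmetric in the edge: `(mid − c_t)² =
(mid − c_v)²`). [cite: DuminilCopinSmirnov2012, §3 (summation by parts)] -/
theorem twisted_regroup (Λ : Finset HexVertex) (F : Sym2 HexVertex → ℂ) (Fb : ℂ) (δ : ℝ)
    (ψ : ℂ → ℂ) :
    ∑ v ∈ Λ.filter (fun v => v.2 = 0), ∑ t ∈ Λ.filter (fun t => hexGraph.Adj v t),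
        12 * (hexMidpoint s(v, t) - hexCenter v) ^ 2 * ψ ((δ : ℂ) * hexMidpoint s(v, t)) *
          ((δ : ℂ) ^ 2 * F s(v, t) / Fb) =
      ∑ v ∈ Λ, ∑ t ∈ Λ.filter (fun t => hexGraph.Adj v t),
        6 * (hexMidpoint s(v, t) - hexCenter v) ^ 2 * ψ ((δ : ℂ) * hexMidpoint s(v, t)) *
          ((δ : ℂ) ^ 2 * F s(v, t) / Fb) := by
  rw [greenLimit_sum_adj_eq_sum_black]
  refine Finset.sum_congr rfl fun v _ => Finset.sum_congr rfl fun t _ => ?_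
  have hsym : s(t, v) = s(v, t) := Sym2.eq_swap
  have hmid : hexMidpoint s(v, t) - hexCenter t = -(hexMidpoint s(v, t) - hexCenter v) := by
    rw [hexMidpoint_mk]; ring
  rw [hsym, hmid]
  ring

/-- **The star of one vertex.** Its contribution factors through the conjugated star sum:
`Σ_t 6 (mid − c_v)² ψ(δ mid) δ²F/F_b = (±9a³ δ²/F_b) · Σ_t conj(mid − c_v) ψ(δ mid) F`, whence the
norm bound with the factor `6 δ²/‖F_b‖`. [folklore] -/
theorem norm_vertexTwist_le (Λ : Finset HexVertex) (F : Sym2 HexVertex → ℂ) (Fb : ℂ) (δ : ℝ)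
    (ψ : ℂ → ℂ) (v : HexVertex) :
    ‖∑ t ∈ Λ.filter (fun t => hexGraph.Adj v t),
        6 * (hexMidpoint s(v, t) - hexCenter v) ^ 2 * ψ ((δ : ℂ) * hexMidpoint s(v, t)) *
          ((δ : ℂ) ^ 2 * F s(v, t) / Fb)‖ ≤
      6 * (δ ^ 2 / ‖Fb‖) * ‖∑ t ∈ Λ.filter (fun t => hexGraph.Adj v t),
        conj (hexMidpoint s(v, t) - hexCenter v) * ψ ((δ : ℂ) * hexMidpoint s(v, t)) * F s(v, t)‖ := by
  set ε : ℂ := if v.2 = 0 then 1 else -1 with hε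
  have hεn : ‖ε‖ = 1 := by rw [hε]; split_ifs <;> simp
  have hfac : ∑ t ∈ Λ.filter (fun t => hexGraph.Adj v t),
      6 * (hexMidpoint s(v, t) - hexCenter v) ^ 2 * ψ ((δ : ℂ) * hexMidpoint s(v, t)) *
        ((δ : ℂ) ^ 2 * F s(v, t) / Fb) =
      (6 * ε * (3 * vecA ^ 3 / 2) * ((δ : ℂ) ^ 2 / Fb)) *
        ∑ t ∈ Λ.filter (fun t => hexGraph.Adj v t),
          conj (hexMidpoint s(v, t) - hexCenter v) * ψ ((δ : ℂ) * hexMidpoint s(v, t)) * F s(v, t) := by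
    rw [Finset.mul_sum]
    refine Finset.sum_congr rfl fun t ht => ?_
    rw [sq_mid_sub_center (Finset.mem_filter.1 ht).2]
    ring
  rw [hfac, norm_mul]
  refine mul_le_mul_of_nonneg_right ?_ (norm_nonneg _)
  rw [norm_mul, norm_mul, norm_mul, hεn, mul_one, Complex.norm_ofNat]
  have hd : ‖(δ : ℂ) ^ 2 / Fb‖ = δ ^ 2 / ‖Fb‖ := by
    rw [norm_div, norm_pow, Complex.norm_real, Real.norm_eq_abs, sq_abs]
  rw [hd]
  have hnn : 0 ≤ δ ^ 2 / ‖Fb‖ := by positivity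
  calc 6 * ‖(3 * vecA ^ 3 / 2 : ℂ)‖ * (δ ^ 2 / ‖Fb‖) ≤ 6 * 1 * (δ ^ 2 / ‖Fb‖) := by
        gcongr; exact norm_coeff_le_one
    _ = 6 * (δ ^ 2 / ‖Fb‖) := by ring

/-- **Freezing the test function at the centre.** If `‖ψ x − ψ y‖ ≤ L‖x − y‖`, replacing
`ψ(δ·mid{v,t})` by `ψ(δ c_v)` in the conjugated star sum costs at most `(Lδ/4) Σ_t ‖F({v,t})‖`
(`‖mid − c_v‖ ≤ 1/2`). [folklore] -/
theorem norm_conjStar_sub_le (Λ : Finset HexVertex) (F : Sym2 HexVertex → ℂ) {δ L : ℝ} (hδ : 0 ≤ δ)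
    (hL : 0 ≤ L) {ψ : ℂ → ℂ} (hψ : ∀ x y, ‖ψ x - ψ y‖ ≤ L * ‖x - y‖) (v : HexVertex) :
    ‖(∑ t ∈ Λ.filter (fun t => hexGraph.Adj v t),
        conj (hexMidpoint s(v, t) - hexCenter v) * ψ ((δ : ℂ) * hexMidpoint s(v, t)) * F s(v, t)) -
      ψ ((δ : ℂ) * hexCenter v) * ∑ t ∈ Λ.filter (fun t => hexGraph.Adj v t),
        conj (hexMidpoint s(v, t) - hexCenter v) * F s(v, t)‖ ≤
      L * δ / 4 * ∑ t ∈ Λ.filter (fun t => hexGraph.Adj v t), ‖F s(v, t)‖ := by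
  rw [Finset.mul_sum, ← Finset.sum_sub_distrib, Finset.mul_sum]
  refine (norm_sum_le _ _).trans (Finset.sum_le_sum fun t ht => ?_)
  have hadj : hexGraph.Adj v t := (Finset.mem_filter.1 ht).2
  have e : conj (hexMidpoint s(v, t) - hexCenter v) * ψ ((δ : ℂ) * hexMidpoint s(v, t)) * F s(v, t) -
      ψ ((δ : ℂ) * hexCenter v) * (conj (hexMidpoint s(v, t) - hexCenter v) * F s(v, t)) =
      conj (hexMidpoint s(v, t) - hexCenter v) *
        (ψ ((δ : ℂ) * hexMidpoint s(v, t)) - ψ ((δ : ℂ) * hexCenter v)) * F s(v, t) := by ring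
  rw [e, norm_mul, norm_mul, Complex.norm_conj]
  have hd : ‖hexMidpoint s(v, t) - hexCenter v‖ ≤ 1 / 2 := norm_hexMidpoint_sub_hexCenter_le hadj
  have hψd : ‖ψ ((δ : ℂ) * hexMidpoint s(v, t)) - ψ ((δ : ℂ) * hexCenter v)‖ ≤ L * (δ / 2) := by
    refine (hψ _ _).trans (mul_le_mul_of_nonneg_left ?_ hL)
    rw [← mul_sub, norm_mul, Complex.norm_real, Real.norm_of_nonneg hδ]
    exact mul_le_mul_of_nonneg_left hd hδ |>.trans (by linarith)
  calc ‖hexMidpoint s(v, t) - hexCenter v‖ *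
        ‖ψ ((δ : ℂ) * hexMidpoint s(v, t)) - ψ ((δ : ℂ) * hexCenter v)‖ * ‖F s(v, t)‖
      ≤ 1 / 2 * (L * (δ / 2)) * ‖F s(v, t)‖ := by gcongr
    _ = L * δ / 4 * ‖F s(v, t)‖ := by ring

/-! ### 3. Rows, once more: the depth radius fits in the pinned ball -/

/-- Sharper row count: with `δ ≤ ρ/2`, a vertex of `Λ` with scaled centre in `B(c, ρ/4)` lies in a
row `m + k` with `δ (k+1) ≤ ρ` (the hypothesis of `deep_of_row`). [folklore] -/
theorem exists_row_succ_le {Λ : Finset HexVertex} {m : ℤ} {δ ρ : ℝ} {c : ℂ} (hδ : 0 < δ)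
    (hδρ : δ ≤ ρ / 2)
    (hpin : ∀ y : HexVertex, (δ : ℂ) * hexCenter y ∈ ball c ρ → (y ∈ Λ ↔ m ≤ y.1 1))
    (hfloor : |δ * (m : ℝ) * (Real.sqrt 3 / 2) - c.im| < ρ / 4)
    {v : HexVertex} (hvΛ : v ∈ Λ) (hv : (δ : ℂ) * hexCenter v ∈ ball c (ρ / 4)) :
    ∃ k : ℕ, v.1 1 = m + k ∧ δ * ((k : ℝ) + 1) ≤ ρ := by
  obtain ⟨k, hk, -⟩ := exists_row_lt hδ hpin hfloor hvΛ hv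
  refine ⟨k, hk, ?_⟩
  have hk0 : (0 : ℝ) ≤ k := Nat.cast_nonneg k
  have hup : ((δ : ℂ) * hexCenter v).im < c.im + ρ / 4 := by
    have h1 : |((δ : ℂ) * hexCenter v - c).im| ≤ ‖(δ : ℂ) * hexCenter v - c‖ := Complex.abs_im_le_norm _
    rw [Complex.sub_im, ← dist_eq_norm] at h1
    have h2 := (abs_lt.1 (lt_of_le_of_lt h1 (mem_ball.1 hv))).2
    linarith
  have hvim := (im_hexCenter_bounds v).1
  rw [hk] at hvim
  push_cast at hvim
  rw [Complex.mul_im, Complex.ofReal_re, Complex.ofReal_im, zero_mul, add_zero] at hup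
  have hfl := (abs_lt.1 hfloor).1
  have h3 := sqrt_three_gt
  have hmul : δ * (((k : ℝ) + 1 / 3) * (Real.sqrt 3 / 2)) < ρ / 2 := by
    have := mul_le_mul_of_nonneg_left hvim hδ.le
    nlinarith
  -- `δ k √3/2 < ρ/2 − δ√3/6`, so `δ (k+1) ≤ ρ/√3 + 2δ/3 ≤ ρ`
  nlinarith [mul_nonneg hδ.le hk0, mul_nonneg (mul_nonneg hδ.le hk0) (Real.sqrt_nonneg 3),
    Real.sqrt_nonneg 3, Real.sq_sqrt (show (0:ℝ) ≤ 3 by norm_num)]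

/-! ### 4. The twisted term at one mesh -/

/-- **The twisted term at one mesh.** Data at a fixed mesh `δ` (`0 < δ ≤ ρ/2`): a domain `Λ` with
root `a`, pinned at `c` (radius `ρ`) with floor line within `ρ/4` of `im c`; the
`DefectDecoherence` inequality with constants `(C, θ)` AT THIS `Λ`; the row budget with constant `C_B`
and normalising mass `Z_b = ‖F(b)‖ > 0`; a test function `ψ` bounded by `Mψ`, `L`-Lipschitz,
vanishing off `B(c, ρψ)` with `ρψ + δ/2 ≤ ρ/4`.  Then
`‖Σ_{up edges} 12(mid − c_v)² ψ(δ mid) δ²F/F(b)‖ ≤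
 6 C_B δ Σ_{k ≤ K} (Mψ · max(1/2, C 2^θ) · (k+1)^{−θ} + Lδ/4)(k+1)^{3/4}` for `ρ/δ ≤ K + 1`.
[cite: DuminilCopinSmirnov2012, §3 (summation by parts)] -/
theorem twisted_norm_le_at {Λ : Finset HexVertex} {a : Sym2 HexVertex} {m : ℤ} {δ ρ : ℝ} {c : ℂ}
    (hδ : 0 < δ) (hδρ : δ ≤ ρ / 2)
    (hpin : ∀ y : HexVertex, (δ : ℂ) * hexCenter y ∈ ball c ρ → (y ∈ Λ ↔ m ≤ y.1 1))
    (hfloor : |δ * (m : ℝ) * (Real.sqrt 3 / 2) - c.im| < ρ / 4)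
    {C θ : ℝ}
    (hDD : ∀ (v : HexVertex) (R : ℝ), 1 ≤ R →
      (∀ y : HexVertex, dist (hexCenter y) (hexCenter v) ≤ R → y ∈ Λ) →
      ‖∑ t ∈ Λ.filter (fun t => hexGraph.Adj v t), conj (hexMidpoint s(v, t) - hexCenter v) *
          hexParafermionicObservable Λ a hexCriticalFugacity (5 / 8) s(v, t)‖ ≤
        C * R ^ (-θ) * ∑ t ∈ Λ.filter (fun t => hexGraph.Adj v t),
          ‖hexParafermionicObservable Λ a hexCriticalFugacity 0 s(v, t)‖)
    {b : Sym2 HexVertex} {CB : ℝ}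
    (hbudget : ∀ k : ℕ, δ * (∑ᶠ v ∈ {v : HexVertex | v ∈ Λ ∧ (δ : ℂ) * hexCenter v ∈ ball c (ρ / 4) ∧
        v.1 1 = m + k}, starMass Λ a v) ≤ CB * ((k : ℝ) + 1) ^ (3 / 4 : ℝ) *
        ‖hexParafermionicObservable Λ a hexCriticalFugacity 0 b‖)
    (hFb : ‖hexParafermionicObservable Λ a hexCriticalFugacity (5 / 8) b‖ =
      ‖hexParafermionicObservable Λ a hexCriticalFugacity 0 b‖)
    (hFb0 : hexParafermionicObservable Λ a hexCriticalFugacity (5 / 8) b ≠ 0)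
    {ψ : ℂ → ℂ} {Mψ L ρψ : ℝ} (hMψ : ∀ z, ‖ψ z‖ ≤ Mψ) (hL : 0 ≤ L)
    (hψL : ∀ x y, ‖ψ x - ψ y‖ ≤ L * ‖x - y‖) (hψs : ∀ z, ψ z ≠ 0 → z ∈ ball c ρψ)
    (hρψ : ρψ + δ / 2 ≤ ρ / 4) {K : ℕ} (hK : ρ / δ ≤ (K : ℝ) + 1) :
    ‖∑ v ∈ Λ.filter (fun v => v.2 = 0), ∑ t ∈ Λ.filter (fun t => hexGraph.Adj v t),
        12 * (hexMidpoint s(v, t) - hexCenter v) ^ 2 * ψ ((δ : ℂ) * hexMidpoint s(v, t)) *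
          ((δ : ℂ) ^ 2 * hexParafermionicObservable Λ a hexCriticalFugacity (5 / 8) s(v, t) /
            hexParafermionicObservable Λ a hexCriticalFugacity (5 / 8) b)‖ ≤
      6 * CB * δ * ∑ k ∈ Finset.range (K + 1),
        (Mψ * max (1 / 2) (C * 2 ^ θ) * ((k : ℝ) + 1) ^ (-θ) + L * δ / 4) * ((k : ℝ) + 1) ^ (3 / 4 : ℝ) := by
  set F : Sym2 HexVertex → ℂ := hexParafermionicObservable Λ a hexCriticalFugacity (5 / 8) with hFdef
  set Z : Sym2 HexVertex → ℂ := hexParafermionicObservable Λ a hexCriticalFugacity 0 with hZdef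
  set Fb : ℂ := F b with hFbdef
  set A₀ : ℝ := max (1 / 2) (C * 2 ^ θ) with hA₀
  set wt : ℕ → ℝ := fun k => Mψ * A₀ * ((k : ℝ) + 1) ^ (-θ) + L * δ / 4 with hwt
  have hMψ0 : 0 ≤ Mψ := (norm_nonneg _).trans (hMψ 0)
  have hA₀0 : 0 ≤ A₀ := le_max_of_le_left (by norm_num)
  have hwt0 : ∀ k, 0 ≤ wt k := fun k => by
    simp only [hwt]
    have : 0 ≤ ((k : ℝ) + 1) ^ (-θ) := Real.rpow_nonneg (by positivity) _
    positivity
  have hFbpos : 0 < ‖Fb‖ := norm_pos_iff.2 hFb0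
  -- star masses: `|F_{5/8}| ≤ Z`, summed over the star
  have hstar : ∀ v, ∑ t ∈ Λ.filter (fun t => hexGraph.Adj v t), ‖F s(v, t)‖ ≤ starMass Λ a v :=
    fun v => Finset.sum_le_sum fun t _ => GateMass.norm_obs_le_norm_obs_zero Λ a (5 / 8) s(v, t)
  have hstar0 : ∀ v, 0 ≤ starMass Λ a v := fun v => Finset.sum_nonneg fun t _ => norm_nonneg _
  -- regroup by vertices
  rw [twisted_regroup]
  set W : HexVertex → ℝ := fun v =>
    if (δ : ℂ) * hexCenter v ∈ ball c (ρ / 4) then wt (v.1 1 - m).toNat else 0 with hW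
  have hvertex : ∀ v ∈ Λ, ‖∑ t ∈ Λ.filter (fun t => hexGraph.Adj v t),
      6 * (hexMidpoint s(v, t) - hexCenter v) ^ 2 * ψ ((δ : ℂ) * hexMidpoint s(v, t)) *
        ((δ : ℂ) ^ 2 * F s(v, t) / Fb)‖ ≤ 6 * (δ ^ 2 / ‖Fb‖) * (W v * starMass Λ a v) := by
    intro v hvΛ
    by_cases hvb : (δ : ℂ) * hexCenter v ∈ ball c (ρ / 4)
    swap
    · -- off the quarter ball every `ψ(δ mid)` vanishes
      have h0 : ∀ t ∈ Λ.filter (fun t => hexGraph.Adj v t),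
          6 * (hexMidpoint s(v, t) - hexCenter v) ^ 2 * ψ ((δ : ℂ) * hexMidpoint s(v, t)) *
            ((δ : ℂ) ^ 2 * F s(v, t) / Fb) = 0 := by
        intro t ht
        have hadj : hexGraph.Adj v t := (Finset.mem_filter.1 ht).2
        have hψ0 : ψ ((δ : ℂ) * hexMidpoint s(v, t)) = 0 := by
          by_contra hne
          apply hvb
          have hm := hψs _ hne
          rw [mem_ball] at hm ⊢
          have hd : dist ((δ : ℂ) * hexCenter v) ((δ : ℂ) * hexMidpoint s(v, t)) ≤ δ / 2 := by
            rw [dist_comm, dist_smul_mesh hδ.le, dist_eq_norm]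
            exact (mul_le_mul_of_nonneg_left (norm_hexMidpoint_sub_hexCenter_le hadj) hδ.le).trans
              (by linarith)
          calc dist ((δ : ℂ) * hexCenter v) c ≤ dist ((δ : ℂ) * hexCenter v) ((δ : ℂ) * hexMidpoint s(v, t)) +
              dist ((δ : ℂ) * hexMidpoint s(v, t)) c := dist_triangle _ _ _
            _ < δ / 2 + ρψ := add_lt_add_of_le_of_lt hd hm
            _ ≤ ρ / 4 := by linarith
        rw [hψ0]; ring
      rw [Finset.sum_eq_zero h0, norm_zero, hW]
      simp only [if_neg hvb, zero_mul, mul_zero]; exact le_rfl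
    -- on the quarter ball: factor, freeze `ψ`, and apply decoherence / the trivial bound
    obtain ⟨k, hk, hkρ⟩ := exists_row_succ_le hδ hδρ hpin hfloor hvΛ hvb
    have hkto : (v.1 1 - m).toNat = k := by rw [hk]; simp
    have hWv : W v = wt k := by simp only [hW, if_pos hvb, hkto]
    rw [hWv]
    refine (norm_vertexTwist_le Λ F Fb δ ψ v).trans ?_
    refine mul_le_mul_of_nonneg_left ?_ (by positivity)
    set S : ℂ := ∑ t ∈ Λ.filter (fun t => hexGraph.Adj v t),
      conj (hexMidpoint s(v, t) - hexCenter v) * F s(v, t) with hS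
    have hfreeze : ‖(∑ t ∈ Λ.filter (fun t => hexGraph.Adj v t),
        conj (hexMidpoint s(v, t) - hexCenter v) * ψ ((δ : ℂ) * hexMidpoint s(v, t)) * F s(v, t)) -
        ψ ((δ : ℂ) * hexCenter v) * S‖ ≤
        L * δ / 4 * ∑ t ∈ Λ.filter (fun t => hexGraph.Adj v t), ‖F s(v, t)‖ :=
      norm_conjStar_sub_le Λ F hδ.le hL hψL v
    have hSbound : ‖S‖ ≤ A₀ * ((k : ℝ) + 1) ^ (-θ) * starMass Λ a v := by
      rcases Nat.eq_zero_or_pos k with hk0 | hkpos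
      · -- row `0`: the trivial bound `‖S‖ ≤ starMass/2`
        subst hk0
        have htriv : ‖S‖ ≤ 1 / 2 * starMass Λ a v := by
          rw [hS, starMass, Finset.mul_sum]
          refine (norm_sum_le _ _).trans (Finset.sum_le_sum fun t ht => ?_)
          have hadj : hexGraph.Adj v t := (Finset.mem_filter.1 ht).2
          rw [norm_mul, Complex.norm_conj]
          exact mul_le_mul (norm_hexMidpoint_sub_hexCenter_le hadj)
            (GateMass.norm_obs_le_norm_obs_zero Λ a (5 / 8) s(v, t)) (norm_nonneg _) (by norm_num)
        refine htriv.trans ?_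
        simp only [Nat.cast_zero, zero_add, Real.one_rpow, mul_one]
        exact mul_le_mul_of_nonneg_right (le_max_left _ _) (hstar0 v)
      · -- row `k ≥ 1`: decoherence at depth `(k+1)/2 ≥ 1`
        have hR1 : (1 : ℝ) ≤ ((k : ℝ) + 1) / 2 := by
          have : (1 : ℝ) ≤ k := by exact_mod_cast hkpos
          linarith
        have hdeep := deep_of_row hδ hpin hk hvb hkρ
        have hD := hDD v (((k : ℝ) + 1) / 2) hR1 hdeep
        rw [← hS] at hD
        refine hD.trans ?_
        rw [starMass]
        refine mul_le_mul_of_nonneg_right ?_ (Finset.sum_nonneg fun _ _ => norm_nonneg _)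
        have hk1 : (0 : ℝ) < (k : ℝ) + 1 := by positivity
        have hrpow : (((k : ℝ) + 1) / 2) ^ (-θ) = 2 ^ θ * ((k : ℝ) + 1) ^ (-θ) := by
          rw [Real.div_rpow hk1.le (by norm_num), Real.rpow_neg (by norm_num : (0:ℝ) ≤ 2),
            Real.rpow_neg hk1.le, div_inv_eq_mul, mul_comm]
        rw [hrpow, ← mul_assoc]
        exact mul_le_mul_of_nonneg_right (le_max_right _ _) (Real.rpow_nonneg hk1.le _)
    have hψv : ‖ψ ((δ : ℂ) * hexCenter v)‖ ≤ Mψ := hMψ _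
    calc ‖∑ t ∈ Λ.filter (fun t => hexGraph.Adj v t),
          conj (hexMidpoint s(v, t) - hexCenter v) * ψ ((δ : ℂ) * hexMidpoint s(v, t)) * F s(v, t)‖
        ≤ ‖ψ ((δ : ℂ) * hexCenter v) * S‖ + L * δ / 4 *
            ∑ t ∈ Λ.filter (fun t => hexGraph.Adj v t), ‖F s(v, t)‖ := by
          exact (norm_le_norm_add_norm_sub' _ (ψ ((δ : ℂ) * hexCenter v) * S)).trans
            (by linarith [hfreeze])
      _ ≤ Mψ * (A₀ * ((k : ℝ) + 1) ^ (-θ) * starMass Λ a v) +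
            L * δ / 4 * starMass Λ a v := by
          rw [norm_mul]
          gcongr
          · exact hstar v
      _ = wt k * starMass Λ a v := by simp only [hwt]; ring
  -- sum over vertices and the layer cake
  have hsum : ‖∑ v ∈ Λ, ∑ t ∈ Λ.filter (fun t => hexGraph.Adj v t),
      6 * (hexMidpoint s(v, t) - hexCenter v) ^ 2 * ψ ((δ : ℂ) * hexMidpoint s(v, t)) *
        ((δ : ℂ) ^ 2 * F s(v, t) / Fb)‖ ≤
      6 * (δ ^ 2 / ‖Fb‖) * ∑ v ∈ Λ, W v * starMass Λ a v := by
    rw [Finset.mul_sum]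
    exact (norm_sum_le _ _).trans (Finset.sum_le_sum hvertex)
  have hfilter : ∑ v ∈ Λ, W v * starMass Λ a v =
      ∑ v ∈ Λ.filter (fun v => (δ : ℂ) * hexCenter v ∈ ball c (ρ / 4)),
        wt (v.1 1 - m).toNat * starMass Λ a v := by
    rw [Finset.sum_filter]
    refine Finset.sum_congr rfl fun v _ => ?_
    simp only [hW]
    split_ifs <;> simp
  have hcake := layerCake_le (a := a) hδ hpin hfloor hbudget wt hwt0 hK
  rw [hfilter] at hsum
  refine hsum.trans ?_
  have hZb : ‖Z b‖ = ‖Fb‖ := by rw [hFbdef, hFdef, hFb]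
  rw [hZb] at hcake
  -- `6 (δ²/‖Fb‖) Σ ≤ 6 (δ/‖Fb‖) · C_B ‖Fb‖ Σ_k = 6 C_B δ Σ_k`
  have hSum : δ ^ 2 / ‖Fb‖ * ∑ v ∈ Λ.filter (fun v => (δ : ℂ) * hexCenter v ∈ ball c (ρ / 4)),
      wt (v.1 1 - m).toNat * starMass Λ a v ≤
      CB * δ * ∑ k ∈ Finset.range (K + 1), wt k * ((k : ℝ) + 1) ^ (3 / 4 : ℝ) := by
    have e : δ ^ 2 / ‖Fb‖ * ∑ v ∈ Λ.filter (fun v => (δ : ℂ) * hexCenter v ∈ ball c (ρ / 4)),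
        wt (v.1 1 - m).toNat * starMass Λ a v =
        δ / ‖Fb‖ * (δ * ∑ v ∈ Λ.filter (fun v => (δ : ℂ) * hexCenter v ∈ ball c (ρ / 4)),
          wt (v.1 1 - m).toNat * starMass Λ a v) := by ring
    rw [e]
    calc δ / ‖Fb‖ * (δ * ∑ v ∈ Λ.filter (fun v => (δ : ℂ) * hexCenter v ∈ ball c (ρ / 4)),
          wt (v.1 1 - m).toNat * starMass Λ a v)
        ≤ δ / ‖Fb‖ * (CB * ‖Fb‖ * ∑ k ∈ Finset.range (K + 1), wt k * ((k : ℝ) + 1) ^ (3 / 4 : ℝ)) :=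
          mul_le_mul_of_nonneg_left hcake (by positivity)
      _ = CB * δ * ∑ k ∈ Finset.range (K + 1), wt k * ((k : ℝ) + 1) ^ (3 / 4 : ℝ) := by
          field_simp
  calc 6 * (δ ^ 2 / ‖Fb‖) * ∑ v ∈ Λ.filter (fun v => (δ : ℂ) * hexCenter v ∈ ball c (ρ / 4)),
        wt (v.1 1 - m).toNat * starMass Λ a v
      = 6 * (δ ^ 2 / ‖Fb‖ * ∑ v ∈ Λ.filter (fun v => (δ : ℂ) * hexCenter v ∈ ball c (ρ / 4)),
        wt (v.1 1 - m).toNat * starMass Λ a v) := by ring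
    _ ≤ 6 * (CB * δ * ∑ k ∈ Finset.range (K + 1), wt k * ((k : ℝ) + 1) ^ (3 / 4 : ℝ)) :=
        mul_le_mul_of_nonneg_left hSum (by norm_num)
    _ = 6 * CB * δ * ∑ k ∈ Finset.range (K + 1),
        (Mψ * max (1 / 2) (C * 2 ^ θ) * ((k : ℝ) + 1) ^ (-θ) + L * δ / 4) * ((k : ℝ) + 1) ^ (3 / 4 : ℝ) := by
        simp only [hwt, hA₀]; ring

/-! ### Registered form (sub-goal of `stub_gateDbarLimit`) -/

/-- **Registered sub-goal `gateDbar_twistedAt`** (crux item stmt-CriticalPhenomena-14004, line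
`polygon-parity-squeeze`, stub `stub_gateDbarLimit`, mechanism (C)): registry form (one `∀`-term) of
`twisted_norm_le_at` — the twisted term of the gate identity at one mesh is bounded by the
decoherence-weighted layer sums. [cite: DuminilCopinSmirnov2012, §3 (summation by parts)] -/
theorem gateDbar_twistedAt : ∀ (Λ : Finset HexVertex) (a b : Sym2 HexVertex) (m : ℤ) (δ ρ C θ CB Mψ L ρψ : ℝ) (c : ℂ) (ψ : ℂ → ℂ) (K : ℕ), 0 < δ → δ ≤ ρ / 2 → (∀ y : HexVertex, (δ : ℂ) * hexCenter y ∈ Metric.ball c ρ → (y ∈ Λ ↔ m ≤ y.1 1)) → |δ * (m : ℝ) * (Real.sqrt 3 / 2) - c.im| < ρ / 4 → (∀ (v : HexVertex) (R : ℝ), 1 ≤ R → (∀ y : HexVertex, dist (hexCenter y) (hexCenter v) ≤ R → y ∈ Λ) → ‖∑ t ∈ Λ.filter (fun t => hexGraph.Adj v t), (starRingEnd ℂ) (hexMidpoint s(v, t) - hexCenter v) * hexParafermionicObservable Λ a hexCriticalFugacity (5 / 8) s(v, t)‖ ≤ C * R ^ (-θ) * ∑ t ∈ Λ.filter (fun t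 => hexGraph.Adj v t), ‖hexParafermionicObservable Λ a hexCriticalFugacity 0 s(v, t)‖) → (∀ k : ℕ, δ * (∑ᶠ v ∈ {v : HexVertex | v ∈ Λ ∧ (δ : ℂ) * hexCenter v ∈ Metric.ball c (ρ / 4) ∧ v.1 1 = m + k}, starMass Λ a v) ≤ CB * ((k : ℝ) + 1) ^ (3 / 4 : ℝ) * ‖hexParafermionicObservable Λ a hexCriticalFugacity 0 b‖) → ‖hexParafermionicObservable Λ a hexCriticalFugacity (5 / 8) b‖ = ‖hexParafermionicObservable Λ a hexCriticalFugacity 0 b‖ → hexParafermionicObservable Λ a hexCriticalFugacity (5 / 8) b ≠ 0 → (∀ z, ‖ψ z‖ ≤ Mψ) → 0 ≤ L → (∀ x y, ‖ψ x - ψ y‖ ≤ L * ‖x - y‖) → (∀ z, ψ z ≠ 0 → z ∈ Metric.ball c ρψ) → ρψ + δ / 2 ≤ ρ / 4 → ρ / δ ≤ (K : ℝ) + 1 → ‖∑ v ∈ Λ.filter (fun v => v.2 = 0), ∑ t ∈ Λ.filter (fun t => hexGraph.Adj v t), 12 * (hexMidpoint s(v, t) - hexCenter v) ^ 2 * ψ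 ((δ : ℂ) * hexMidpoint s(v, t)) * ((δ : ℂ) ^ 2 * hexParafermionicObservable Λ a hexCriticalFugacity (5 / 8) s(v, t) / hexParafermionicObservable Λ a hexCriticalFugacity (5 / 8) b)‖ ≤ 6 * CB * δ * ∑ k ∈ Finset.range (K + 1), (Mψ * max (1 / 2) (C * 2 ^ θ) * ((k : ℝ) + 1) ^ (-θ) + L * δ / 4) * ((k : ℝ) + 1) ^ (3 / 4 : ℝ) :=
  fun _ _ _ _ _ _ _ _ _ _ _ _ _ _ _ hδ hδρ hpin hfloor hDD hbudget hFb hFb0 hMψ hL hψL hψs hρψ hK =>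
    twisted_norm_le_at hδ hδρ hpin hfloor hDD hbudget hFb hFb0 hMψ hL hψL hψs hρψ hK

end Summit.CriticalPhenomena.SAWScalingLimit.Theorems.PolygonParitySqueeze.GateDbar

end
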